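import Literature.MathematicalPhysics.QuantumFieldTheory.Balaban1983to89.B7Prop9GeneralRec

/-!
# `Balaban1983to89.B7Eq199GeneralRec` — [Balaban1985Averaging] Proposition 9 (p. 49), (197)∕(199) AT A GENERAL REGULAR BACKGROUND, FOR THE RECORD (centred blocks, (0.4) average) — the record twin
# of the engine's `B7Prop9General` §7–§9, sequel of `B7Prop9GeneralRec`

statement-level skeleton of published theorems with citation tags; proofs where landed; nothing here is a claim about the Yang–Mills mass gap

CITATION HEADER (lean-in-tree rule).  Cell `pub-ymgap`, seat `pub-ymgap-dag-n05-e` g36 (N05-REC LEAD PEN); item R1 ([3] layer), Sect. G block, file 3.  `--kind proof --supports stmt-QuantumFields-20541` (K0⁷;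
count-neutral; no definition).  Sources READ: [3] = [Balaban1985Averaging] pp. 45–49 (176)–(200) (`paper:balaban1985-cmp98-averaging`); [I] = [Balaban1987RG1] (0.3)–(0.4) pp. 252–253.  REUSED BY NAME:
`B7Prop9GeneralRec` (§1–§4: boxes, `rotClamp` facts, `savgZ_Rc`, `eq200Z_general`, `gauge2Z_bond_bound`), `B7Prop9FlatRec.core199Z`, the engine's `B7Prop9General.{rotClamp, rotClamp_mul, siteBd_rotClamp,
bondBd_rotClamp, prod_block_lt_one, norm_Rc_expUnit_sub_self_le, CovBondBd}`, `B7Prop9Flat.{setup, arith199, C4', C5'}`, dag-n05-d's `B8Lemma1NonAbelianRecLoops.norm_XZ_le`.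

WHAT IS PROVED (sorry-free; `L = 2s + 1`, `d ≥ 1`).  ★`eq199Z_general_seg` ((197)∕(199) with the straight transporter `V₀(c)`: `≤ L·a′ + C′₄L²(α′₃a′ + a′²)`, `a′ = α′₄ + 16(d+1)²L²α₀α₄`, by reduction to
`core199Z` in the two-block gauge), `norm_XZ_le_global` (`‖X_c‖ ≤ 32(d+1)(d+4)L²α₀` for the record's averaged bond exponent), ★`eq199Z_general` (with print's `R̄_{0,c} = R(V̄₀(c))`, `V̄₀ = bavgZ L V₀`),
★★`prop9_generalZ` — PROPOSITION 9 FOR THE RECORD packaged as (180b)∕(180a) one scale up at `rescale L (bavgZ L V₀)`, with the engine's constants.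
HONEST SCOPE.  Port of the engine's estimates (same constants, same honest weakenings as the engine's READINGS); Prop. 10 for the record is the sequel; nothing of [3]∕[I] asserted beyond what is proved;
`HThm4Rec` UNDISCHARGED; N05 discharged of record untouched; N07 not claimable; counts unmoved (typed 28∕28 · discharged 8∕28); one finite 𝕋⁴ programme at fixed ε — nothing continuum ∕ ℝ⁴ ∕ OS ∕ mass gap ∕
Clay.  No `def`, no `instance`, no `notation`, no `sorry`.
-/

set_option autoImplicit false

noncomputable section

open NormedSpace Finset Metric

namespace Literature.MathematicalPhysics.QuantumFieldTheory.Balaban1983to89.B7Eq199GeneralRec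

open B7Prop1Explicit hiding Site
open B7Prop1Explicit renaming Site → SiteZ
open MatrixLog B7Eq92Concrete B7Eq170Flat
open B7Eq99Concrete (R0fun R0fun_apply R0fun_self R0fun_add)
open B7Prop6Flat (norm_units_inv_sub_one_le)
open B7Prop9Flat (SiteBd BondBd setup arith199 C4' C5')
open B7Prop9General (clamp rotClamp rotClamp_mul siteBd_rotClamp bondBd_rotClamp prod_block_lt_one norm_Rc_expUnit_sub_self_le CovBondBd)
open BlockAveragingZd (IdxZ offZ XZ WZ bavgZ natAbs_offZ_le)
open B8Lemma1NonAbelian (zsmul_e_apply)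
open B8Lemma1NonAbelianRecLoops (halfVec pairLo pairHi norm_XZ_le omegaC)
open B7SectCDGaugeAveragesRec (SexpZ savgZ R0avgZ)
open B7SectEFLinearisationRec (CovBlockBdZ vtilGZ)
open B7Prop9FlatRec (savgZ_apply core199Z)
open B7Prop9GeneralRec (clamp_of_mem pairBox_le mem_pairBox_points savgZ_congr savgZ_Rc norm_Rc_sub_one_le eq200Z_general gauge2Z_bond_bound)

variable {d : ℕ}

/-! ## §1 (197)/(199) at a general background, for the record -/

section Eq199

variable {𝔸 : Type*} [NormedRing 𝔸] [NormOneClass 𝔸] [NormedAlgebra ℂ 𝔸] [CompleteSpace 𝔸]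
variable {L s : ℕ}

/-- ★ **(197)/(199) AT A GENERAL BACKGROUND `V₀`, FOR THE RECORD, straight coarse transporter** — the engine's `eq199_general_seg` with centred blocks: under (180a)–(180d) (`CovBlockBdZ`), `α₄ ≤ 1/10`,
`50Lα′₃ ≤ 1`, and `10³(d+1)L·a′ ≤ 1`, `a′ := α′₄ + 16(d+1)²L²·α₀α₄`: `‖ṽ′(c₋)⁻¹·R(V₀(c))ṽ′(c₊) − 1‖ ≤ L·a′ + C′₄L²(α′₃a′ + a′²)` for the record's `ṽ′ = vtilGZ`, `c = ⟨Lz, L(z + e_μ)⟩`, `V₀(c)` the straight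
contour.  PROOF = reduction to `core199Z` in the two-block gauge (axial at `c₋` on `{x_μ ≤ q_μ + s}`, `V₀(c)`·axial at `c₊` beyond). [cite: Balaban1985Averaging, Proposition 9 (199) p.49, (197) p.48, (180)–(196) pp.46–48, (78)–(79) p.30; Balaban1987RG1, (0.3) p.252] -/
theorem eq199Z_general_seg (hLs : L = 2 * s + 1) (hd : 1 ≤ d) {V₀ : SiteZ d → Fin d → 𝔸ˣ} (hV : ∀ x κ, V₀ x κ ∈ U1 𝔸)
    {α₀ : ℝ} (hα₀ : 0 ≤ α₀)
    (h44 : ∀ (x : SiteZ d) (κ μ : Fin d), κ ≠ μ → ‖((hol V₀ x (plaqWord κ μ) : 𝔸ˣ) : 𝔸) - 1‖ ≤ α₀)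
    {v' v₁ : SiteZ d → 𝔸ˣ} {α₃ α₃' α₄ α₄' : ℝ}
    (h4a : SiteBd v' α₄) (h4b : CovBondBd V₀ v' α₄') (h3c : SiteBd v₁ α₃) (h3d : CovBlockBdZ L V₀ v₁ (L * α₃'))
    (hα₄ : α₄ ≤ 1 / 10) (hα₄' : 0 ≤ α₄') (hα₃ : α₃ ≤ 1 / 5) (hα₃' : 50 * (L * α₃') ≤ 1)
    (hs : 1000 * ((d : ℝ) + 1) * L * (α₄' + 16 * ((d : ℝ) + 1) ^ 2 * L ^ 2 * α₀ * α₄) ≤ 1)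
    (z : SiteZ d) (μ : Fin d) :
    ‖((((vtilGZ L V₀ v' v₁ ((L : ℤ) • z))⁻¹ *
        Rc (hol V₀ ((L : ℤ) • z) (seg μ L)) (vtilGZ L V₀ v' v₁ ((L : ℤ) • (z + e μ))) : 𝔸ˣ)) : 𝔸) - 1‖
      ≤ L * (α₄' + 16 * ((d : ℝ) + 1) ^ 2 * L ^ 2 * α₀ * α₄) +
        C4' d * L ^ 2 * (α₃' * (α₄' + 16 * ((d : ℝ) + 1) ^ 2 * L ^ 2 * α₀ * α₄) +
          (α₄' + 16 * ((d : ℝ) + 1) ^ 2 * L ^ 2 * α₀ * α₄) ^ 2) := by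
  have hL : 1 ≤ L := by omega
  set q : SiteZ d := (L : ℤ) • z with hq
  have hq'z : (L : ℤ) • (z + e μ) = q + (L : ℤ) • e μ := by rw [hq, smul_add]
  set S : 𝔸ˣ := hol V₀ q (seg μ L) with hSdef
  obtain ⟨ŵ, hŵ⟩ : ∃ ŵ : SiteZ d → 𝔸ˣ, ∀ x, ŵ x = if x μ ≤ q μ + s then axialFn V₀ q x else S * axialFn V₀ (q + (L : ℤ) • e μ) x :=
    ⟨fun x => if x μ ≤ q μ + s then axialFn V₀ q x else S * axialFn V₀ (q + (L : ℤ) • e μ) x, fun x => rfl⟩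
  set lo : SiteZ d := pairLo L q with hlo
  set up : SiteZ d := pairHi L q μ with hup
  set W' : SiteZ d → 𝔸ˣ := rotClamp ŵ lo up v' with hW'
  set W₁ : SiteZ d → 𝔸ˣ := rotClamp ŵ lo up v₁ with hW₁
  set a' : ℝ := α₄' + 16 * ((d : ℝ) + 1) ^ 2 * L ^ 2 * α₀ * α₄ with ha'
  have hα₄0 : 0 ≤ α₄ := (norm_nonneg _).trans (h4a 0)
  have hS : S ∈ U1 𝔸 := hol_mem hV _ _
  have hŵU : ∀ x, ŵ x ∈ U1 𝔸 := fun x => by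
    rw [hŵ]
    split_ifs
    · exact axialFn_mem hV _ _
    · exact (U1 𝔸).mul_mem (hol_mem hV _ _) (axialFn_mem hV _ _)
  have hbox : ∀ i : Fin d, lo i ≤ up i := pairBox_le L q μ
  have hg0 : 0 ≤ 4 * ((d : ℝ) + 1) ^ 2 * L ^ 2 * α₀ := by positivity
  have hG : ∀ (p : SiteZ d) (κ : Fin d), (∀ i : Fin d, lo i ≤ p i ∧ p i ≤ up i) → (∀ i : Fin d, lo i ≤ (p + e κ) i ∧ (p + e κ) i ≤ up i) →
      ‖((gaugeAct ŵ V₀ p κ : 𝔸ˣ) : 𝔸) - 1‖ ≤ 4 * ((d : ℝ) + 1) ^ 2 * L ^ 2 * α₀ :=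
    fun p κ hp hp' => gauge2Z_bond_bound hLs hd hV hα₀ h44 q μ hŵ hp hp'
  have h4bW : BondBd W' a' := by
    have h := bondBd_rotClamp hbox hŵU hV hg0 hG h4a (hα₄.trans (by norm_num)) h4b hα₄'
    rw [hW', ha']
    convert h using 2
    ring
  have h4aW : SiteBd W' α₄ := siteBd_rotClamp hŵU _ _ h4a
  have h3cW : SiteBd W₁ α₃ := siteBd_rotClamp hŵU _ _ h3c
  have ha'0 : 0 ≤ a' := by rw [ha']; positivity
  obtain ⟨hVA, h4, ha0, ha2, hθ0, hθ1, hθ2⟩ := setup hL h4bW ha'0 hs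
  have hL' : (1 : ℝ) ≤ L := by exact_mod_cast hL
  have hK : (1 : ℝ) ≤ (d : ℝ) + 1 := by have := Nat.cast_nonneg (α := ℝ) d; linarith
  have hw' : ∀ x, ‖((W₁ x : 𝔸ˣ) : 𝔸) - 1‖ ≤ 2 / 5 := fun x => (h3cW x).trans (by linarith)
  have hwi : ∀ x, ‖((((W₁ x)⁻¹ : 𝔸ˣ)) : 𝔸) - 1‖ ≤ 2 / 5 := fun x =>
    (norm_units_inv_sub_one_le (W₁ x) ((h3cW x).trans (by linarith))).trans (by linarith [h3cW x])
  have hq1 : (L : ℝ) * α₃' ≤ 1 / 50 := by linarith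
  have hq0 : 0 ≤ (L : ℝ) * α₃' := (norm_nonneg _).trans (h3d 0 fun _ => ⟨0, hL⟩)
  -- the values of the gauge on the two blocks
  have hsL : (s : ℤ) < L := by omega
  have hn : ∀ (r : Fin d → Fin L) (i : Fin d), -(s : ℤ) ≤ offZ L r i ∧ offZ L r i ≤ s := fun r i => by
    have := natAbs_offZ_le hLs r i; omega
  have hŵq : ŵ q = 1 := by
    have : q μ ≤ q μ + s := by omega
    rw [hŵ, if_pos this]
    simp [axialFn]
  have hŵblk : ∀ r : Fin d → Fin L, ŵ (q + offZ L r) = hol V₀ q (treeWord (offZ L r)) := by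
    intro r
    have : (q + offZ L r) μ ≤ q μ + s := by have := hn r μ; simp only [Pi.add_apply]; omega
    rw [hŵ, if_pos this, axialFn, add_sub_cancel_left]
  have hŵq' : ŵ (q + (L : ℤ) • e μ) = S := by
    have : ¬ (q + (L : ℤ) • e μ) μ ≤ q μ + s := by simp only [Pi.add_apply, zsmul_e_apply, if_true]; omega
    rw [hŵ, if_neg this]
    simp [axialFn]
  have hŵblk' : ∀ r : Fin d → Fin L, ŵ (q + (L : ℤ) • e μ + offZ L r) =
      S * hol V₀ (q + (L : ℤ) • e μ) (treeWord (offZ L r)) := by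
    intro r
    have : ¬ (q + (L : ℤ) • e μ + offZ L r) μ ≤ q μ + s := by
      have := hn r μ; simp only [Pi.add_apply, zsmul_e_apply, if_true]; omega
    rw [hŵ, if_neg this, axialFn, add_sub_cancel_left]
  -- box memberships of the four kinds of points
  have hmq : ∀ i : Fin d, lo i ≤ q i ∧ q i ≤ up i := (mem_pairBox_points hLs q μ (fun _ => ⟨0, hL⟩)).1
  have hmqr : ∀ r : Fin d → Fin L, ∀ i : Fin d, lo i ≤ (q + offZ L r) i ∧ (q + offZ L r) i ≤ up i :=
    fun r => (mem_pairBox_points hLs q μ r).2.1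
  have hmq' : ∀ i : Fin d, lo i ≤ (q + (L : ℤ) • e μ) i ∧ (q + (L : ℤ) • e μ) i ≤ up i :=
    (mem_pairBox_points hLs q μ (fun _ => ⟨0, hL⟩)).2.2.1
  have hmq'r : ∀ r : Fin d → Fin L, ∀ i : Fin d,
      lo i ≤ (q + (L : ℤ) • e μ + offZ L r) i ∧ (q + (L : ℤ) • e μ + offZ L r) i ≤ up i :=
    fun r => (mem_pairBox_points hLs q μ r).2.2.2
  -- the block quantities of (180d) for the rotated `v₁`
  have hqb : ∀ r : Fin d → Fin L, ‖((((W₁ q)⁻¹ * W₁ (q + offZ L r) : 𝔸ˣ)) : 𝔸) - 1‖ ≤ L * α₃' := by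
    intro r
    have : (W₁ q)⁻¹ * W₁ (q + offZ L r) = (v₁ q)⁻¹ * R0fun V₀ q v₁ (q + offZ L r) := by
      rw [hW₁]
      simp only [rotClamp, clamp_of_mem hmq, clamp_of_mem (hmqr r), hŵq, hŵblk, R0fun_add, Rc_one_apply]
    rw [this]; exact h3d z r
  have hqb' : ∀ r : Fin d → Fin L, ‖((((W₁ (q + (L : ℤ) • e μ))⁻¹ *
      W₁ (q + (L : ℤ) • e μ + offZ L r) : 𝔸ˣ)) : 𝔸) - 1‖ ≤ L * α₃' := by
    intro r
    have : (W₁ (q + (L : ℤ) • e μ))⁻¹ * W₁ (q + (L : ℤ) • e μ + offZ L r) =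
        Rc S ((v₁ (q + (L : ℤ) • e μ))⁻¹ * R0fun V₀ (q + (L : ℤ) • e μ) v₁ (q + (L : ℤ) • e μ + offZ L r)) := by
      rw [hW₁]
      simp only [rotClamp, clamp_of_mem hmq', clamp_of_mem (hmq'r r), hŵq', hŵblk', R0fun_add, map_mul, map_inv, Rc_mul,
        MonoidHom.comp_apply]
    rw [this]
    refine (norm_Rc_sub_one_le hS _).trans ?_
    have := h3d (z + e μ) r
    rwa [hq'z] at this
  -- the twisted averages ARE flat record averages of the rotated data
  have hid_q : ∀ v : SiteZ d → 𝔸ˣ, savgZ L (rotClamp ŵ lo up v) q = R0avgZ L V₀ v q := fun v => by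
    show savgZ L _ q = savgZ L (R0fun V₀ q v) q
    refine savgZ_congr ?_ fun r => ?_
    · simp only [rotClamp, clamp_of_mem hmq, hŵq, R0fun_self, Rc_one_apply]
    · simp only [rotClamp, clamp_of_mem (hmqr r), hŵblk, R0fun_add]
  have hid_q' : ∀ v : SiteZ d → 𝔸ˣ,
      (∀ r : Fin d → Fin L, ‖((((v (q + (L : ℤ) • e μ))⁻¹ *
        R0fun V₀ (q + (L : ℤ) • e μ) v (q + (L : ℤ) • e μ + offZ L r) : 𝔸ˣ)) : 𝔸) - 1‖ < 1) →
      savgZ L (rotClamp ŵ lo up v) (q + (L : ℤ) • e μ) = Rc S (R0avgZ L V₀ v (q + (L : ℤ) • e μ)) := by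
    intro v hv
    have h1 : savgZ L (rotClamp ŵ lo up v) (q + (L : ℤ) • e μ) =
        savgZ L (fun x => Rc S (R0fun V₀ (q + (L : ℤ) • e μ) v x)) (q + (L : ℤ) • e μ) := by
      refine savgZ_congr ?_ fun r => ?_
      · simp only [rotClamp, clamp_of_mem hmq', hŵq', R0fun_self]
      · simp only [rotClamp, clamp_of_mem (hmq'r r), hŵblk', R0fun_add, Rc_mul, MonoidHom.comp_apply]
    have hv' : ∀ r : Fin d → Fin L, ‖((((R0fun V₀ (q + (L : ℤ) • e μ) v (q + (L : ℤ) • e μ))⁻¹ *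
        R0fun V₀ (q + (L : ℤ) • e μ) v (q + (L : ℤ) • e μ + offZ L r) : 𝔸ˣ)) : 𝔸) - 1‖ < 1 := fun r => by
      rw [R0fun_self]; exact hv r
    rw [h1, savgZ_Rc hS hv']
    rfl
  have hsm₁ : ∀ r : Fin d → Fin L, ‖((((v₁ (q + (L : ℤ) • e μ))⁻¹ *
      R0fun V₀ (q + (L : ℤ) • e μ) v₁ (q + (L : ℤ) • e μ + offZ L r) : 𝔸ˣ)) : 𝔸) - 1‖ < 1 := fun r => by
    have := h3d (z + e μ) r
    rw [hq'z] at this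
    exact this.trans_lt (by linarith)
  have hsm₂ : ∀ r : Fin d → Fin L, ‖(((((v' * v₁) (q + (L : ℤ) • e μ))⁻¹ *
      R0fun V₀ (q + (L : ℤ) • e μ) (v' * v₁) (q + (L : ℤ) • e μ + offZ L r) : 𝔸ˣ)) : 𝔸) - 1‖ < 1 := fun r => by
    have := h3d (z + e μ) r
    rw [hq'z] at this
    exact prod_block_lt_one hV h4a h3c hα₄ hα₃ this hq1
  -- the printed quantity IS the flat coarse bond variable of the rotated data
  have hid : (vtilGZ L V₀ v' v₁ q)⁻¹ * Rc S (vtilGZ L V₀ v' v₁ (q + (L : ℤ) • e μ)) =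
      (savgZ L (W' * W₁) q * (savgZ L W₁ q)⁻¹)⁻¹ *
        (savgZ L (W' * W₁) (q + (L : ℤ) • e μ) * (savgZ L W₁ (q + (L : ℤ) • e μ))⁻¹) := by
    rw [hW', hW₁, ← rotClamp_mul, hid_q, hid_q, hid_q' _ hsm₂, hid_q' _ hsm₁, vtilGZ, vtilGZ, map_mul, map_inv]
  have key := core199Z hL ha0 hVA hθ0 hθ1 le_rfl hwi hw' hq1 q μ hqb hqb'
  rw [hq'z, hid]
  calc _ ≤ _ := key
    _ ≤ _ := arith199 hK hL' ha'0 h4 hq0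
    _ = _ := by rw [C4', ha']; ring

end Eq199

/-! ## §2 (199) with print's rotation `R̄_{0,c} = R(V̄₀(c))`, `V̄₀` the record's averaged background (0.4), and Proposition 9 for the record -/

section Prop9

variable {𝔸 : Type*} [NormedRing 𝔸] [NormOneClass 𝔸] [NormedAlgebra ℂ 𝔸] [CompleteSpace 𝔸]
variable {L s : ℕ}

/-- The record's averaged bond exponent `X_c` ((0.4), `bavgZ L V₀ q μ = e^{X_c}V₀(c)`) is `O(L²α₀)`: `‖X_c‖ ≤ 32(d+1)(d+4)L²α₀` under `512(d+1)(d+4)L²α₀ ≤ 1` — from dag-n05-d's local loop bound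
`norm_XZ_le` (constant `ω = (d−1)s(ds + L) ≤ (d+1)(d+4)L²`). [cite: Balaban1987RG1, (0.4) p.253; Balaban1985Averaging, (42) p.23, p.25] -/
theorem norm_XZ_le_global (hLs : L = 2 * s + 1) {V₀ : SiteZ d → Fin d → 𝔸ˣ} (hV : ∀ x κ, V₀ x κ ∈ U1 𝔸) {α₀ : ℝ} (hα₀ : 0 ≤ α₀)
    (h44 : ∀ (x : SiteZ d) (κ μ : Fin d), κ ≠ μ → ‖((hol V₀ x (plaqWord κ μ) : 𝔸ˣ) : 𝔸) - 1‖ ≤ α₀)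
    (hα₀s : 512 * ((d : ℝ) + 1) * ((d : ℝ) + 4) * L ^ 2 * α₀ ≤ 1) (q : SiteZ d) (μ : Fin d) :
    ‖XZ L V₀ q μ‖ ≤ 32 * ((d : ℝ) + 1) * ((d : ℝ) + 4) * L ^ 2 * α₀ := by
  have hP : B8Lemma1NonAbelian.PlaqSmall V₀ (pairLo L q) (pairHi L q μ) α₀ := fun x κ ν hne _ _ => h44 x κ ν hne
  have hd : (0 : ℝ) ≤ d := Nat.cast_nonneg d
  have hL1 : (1 : ℝ) ≤ L := by exact_mod_cast (show 1 ≤ L by omega)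
  have hω : omegaC d L α₀ ≤ ((d : ℝ) + 1) * ((d : ℝ) + 4) * L ^ 2 * α₀ := by
    unfold omegaC
    set X : ℝ := ((L : ℝ) - 1) / 2 with hX
    have hX0 : 0 ≤ X := by rw [hX]; linarith
    have hXL : X ≤ L := by rw [hX]; linarith
    have h1 : (d : ℝ) * X + L ≤ ((d : ℝ) + 1) * L := by nlinarith
    have h2 : 0 ≤ X * ((d : ℝ) * X + L) := by positivity
    have h3 : ((d : ℝ) - 1) * X * ((d : ℝ) * X + L) ≤ ((d : ℝ) + 1) * X * ((d : ℝ) * X + L) := by nlinarith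
    have h4 : ((d : ℝ) + 1) * X * ((d : ℝ) * X + L) ≤ ((d : ℝ) + 1) * L * (((d : ℝ) + 1) * L) := by
      have := mul_le_mul hXL h1 (by positivity) (by positivity)
      nlinarith
    have h5 : ((d : ℝ) + 1) * L * (((d : ℝ) + 1) * L) ≤ ((d : ℝ) + 1) * ((d : ℝ) + 4) * L ^ 2 := by nlinarith
    have := mul_le_mul_of_nonneg_right (h3.trans (h4.trans h5)) hα₀
    linarith
  have hω2 : omegaC d L α₀ ≤ 1 / 2 := hω.trans (by nlinarith)
  have h := norm_XZ_le hLs V₀ hV hP hα₀ q μ le_rfl le_rfl hω2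
  have hX0 : 0 ≤ ((d : ℝ) + 1) * ((d : ℝ) + 4) * L ^ 2 * α₀ := by positivity
  linarith

/-- ★ **(199) AT A GENERAL BACKGROUND WITH PRINT'S `R̄_{0,c} = R(V̄₀(c))`, FOR THE RECORD** — `V̄₀ = bavgZ L V₀` the record's average (0.4) (`V̄₀(c) = e^{X_c}V₀(c)`): the bound of `eq199Z_general_seg` plus the cost
`384(d+1)(d+4)L²α₀·(α₄ + C′₅L(α′₄ + 4dLα₀α₄))` of the extra rotation `R(e^{X_c})`, under `512(d+1)(d+4)L²α₀ ≤ 1` — same constants as the engine's `eq199_general`.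
[cite: Balaban1985Averaging, Proposition 9 (199) p.49, (197) p.48, (188) p.47, (42)–(43) pp.23–24; Balaban1987RG1, (0.4) p.253] -/
theorem eq199Z_general (hLs : L = 2 * s + 1) (hd : 1 ≤ d) {V₀ : SiteZ d → Fin d → 𝔸ˣ} (hV : ∀ x κ, V₀ x κ ∈ U1 𝔸)
    {α₀ : ℝ} (hα₀ : 0 ≤ α₀)
    (h44 : ∀ (x : SiteZ d) (κ μ : Fin d), κ ≠ μ → ‖((hol V₀ x (plaqWord κ μ) : 𝔸ˣ) : 𝔸) - 1‖ ≤ α₀)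
    {v' v₁ : SiteZ d → 𝔸ˣ} {α₃ α₃' α₄ α₄' : ℝ}
    (h4a : SiteBd v' α₄) (h4b : CovBondBd V₀ v' α₄') (h3c : SiteBd v₁ α₃) (h3d : CovBlockBdZ L V₀ v₁ (L * α₃'))
    (hα₄ : α₄ ≤ 1 / 10) (hα₄' : 0 ≤ α₄') (hα₃ : α₃ ≤ 1 / 5) (hα₃' : 50 * (L * α₃') ≤ 1)
    (hs : 1000 * ((d : ℝ) + 1) * L * (α₄' + 16 * ((d : ℝ) + 1) ^ 2 * L ^ 2 * α₀ * α₄) ≤ 1)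
    (hα₀s : 512 * ((d : ℝ) + 1) * ((d : ℝ) + 4) * L ^ 2 * α₀ ≤ 1)
    (z : SiteZ d) (μ : Fin d) :
    ‖((((vtilGZ L V₀ v' v₁ ((L : ℤ) • z))⁻¹ *
        Rc (bavgZ L V₀ ((L : ℤ) • z) μ) (vtilGZ L V₀ v' v₁ ((L : ℤ) • (z + e μ))) : 𝔸ˣ)) : 𝔸) - 1‖
      ≤ (L * (α₄' + 16 * ((d : ℝ) + 1) ^ 2 * L ^ 2 * α₀ * α₄) +
          C4' d * L ^ 2 * (α₃' * (α₄' + 16 * ((d : ℝ) + 1) ^ 2 * L ^ 2 * α₀ * α₄) +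
            (α₄' + 16 * ((d : ℝ) + 1) ^ 2 * L ^ 2 * α₀ * α₄) ^ 2)) +
        384 * ((d : ℝ) + 1) * ((d : ℝ) + 4) * L ^ 2 * α₀ * (α₄ + C5' d * L * (α₄' + 4 * (d * L * α₀) * α₄)) := by
  have hL : 1 ≤ L := by omega
  have hα₄0 : 0 ≤ α₄ := (norm_nonneg _).trans (h4a 0)
  have hdr : (0 : ℝ) ≤ d := Nat.cast_nonneg d
  have hLr : (1 : ℝ) ≤ L := by exact_mod_cast hL
  have hs200 : 1000 * ((d : ℝ) + 1) * L * (α₄' + 4 * (d * L * α₀) * α₄) ≤ 1 := by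
    have h1 : 4 * ((d : ℝ) * L * α₀) * α₄ ≤ 16 * ((d : ℝ) + 1) ^ 2 * L ^ 2 * α₀ * α₄ := by
      have h2 : (d : ℝ) * L ≤ 4 * ((d : ℝ) + 1) ^ 2 * L ^ 2 := by
        have hKL : 1 ≤ ((d : ℝ) + 1) * L := one_le_mul_of_one_le_of_one_le (by linarith) hLr
        have h5 : (d : ℝ) * L ≤ ((d : ℝ) + 1) * L := by nlinarith
        have h6 : ((d : ℝ) + 1) * L ≤ (((d : ℝ) + 1) * L) ^ 2 := by nlinarith
        nlinarith
      have h3 := mul_le_mul_of_nonneg_right h2 (mul_nonneg hα₀ hα₄0)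
      nlinarith
    have hpos : (0 : ℝ) ≤ 1000 * ((d : ℝ) + 1) * L := by positivity
    nlinarith [mul_le_mul_of_nonneg_left h1 hpos]
  have h199 := eq199Z_general_seg hLs hd hV hα₀ h44 h4a h4b h3c h3d hα₄ hα₄' hα₃ hα₃' hs z μ
  have h200 := eq200Z_general hLs hV hα₀ h44 h4a h4b h3c h3d (hα₄.trans (by norm_num)) hα₄' hα₃ hα₃' hs200 z
  have h200' := eq200Z_general hLs hV hα₀ h44 h4a h4b h3c h3d (hα₄.trans (by norm_num)) hα₄' hα₃ hα₃' hs200 (z + e μ)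
  have hq'z : (L : ℤ) • (z + e μ) = (L : ℤ) • z + (L : ℤ) • e μ := smul_add _ _ _
  rw [hq'z] at h199 h200' ⊢
  set q : SiteZ d := (L : ℤ) • z with hq
  set S : 𝔸ˣ := hol V₀ q (seg μ L) with hSdef
  set E : 𝔸ˣ := expUnit (XZ L V₀ q μ) with hE
  set P : 𝔸ˣ := (vtilGZ L V₀ v' v₁ q)⁻¹ with hP
  set Y : 𝔸ˣ := Rc S (vtilGZ L V₀ v' v₁ (q + (L : ℤ) • e μ)) with hY
  set M : ℝ := α₄ + C5' d * L * (α₄' + 4 * (d * L * α₀) * α₄) with hM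
  have hS : S ∈ U1 𝔸 := hol_mem hV _ _
  have hbavg : bavgZ L V₀ q μ = E * S := rfl
  have hM1 : M ≤ 1 / 4 := by
    have : C5' d * L * (α₄' + 4 * (d * L * α₀) * α₄) ≤ 64 / 1000 := by rw [C5']; nlinarith
    rw [hM]; linarith
  have h200v : ‖((vtilGZ L V₀ v' v₁ q : 𝔸ˣ) : 𝔸) - 1‖ ≤ M := h200
  have hY1 : ‖(Y : 𝔸) - 1‖ ≤ M := (norm_Rc_sub_one_le hS _).trans h200'
  have hPn : ‖(P : 𝔸)‖ ≤ 2 := by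
    have h1 := norm_units_inv_sub_one_le (vtilGZ L V₀ v' v₁ q) (h200v.trans (by linarith))
    calc ‖(P : 𝔸)‖ = ‖((P : 𝔸) - 1) + 1‖ := by rw [sub_add_cancel]
      _ ≤ ‖(P : 𝔸) - 1‖ + ‖(1 : 𝔸)‖ := norm_add_le _ _
      _ ≤ 2 * M + 1 := by rw [norm_one, hP]; linarith
      _ ≤ 2 := by linarith
  set ξ : ℝ := 32 * ((d : ℝ) + 1) * ((d : ℝ) + 4) * L ^ 2 * α₀ with hξ
  have hξ1 : ξ ≤ 1 / 16 := by rw [hξ]; linarith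
  have hX : ‖XZ L V₀ q μ‖ ≤ ξ := norm_XZ_le_global hLs hV hα₀ h44 hα₀s q μ
  have hmove : ‖((Rc E Y : 𝔸ˣ) : 𝔸) - Y‖ ≤ 6 * ξ * M :=
    (norm_Rc_expUnit_sub_self_le hX (by linarith) Y).trans (by
      have hξ0 : 0 ≤ ξ := by rw [hξ]; positivity
      gcongr)
  have hid : ((P * Rc (bavgZ L V₀ q μ) (vtilGZ L V₀ v' v₁ (q + (L : ℤ) • e μ)) : 𝔸ˣ) : 𝔸) - 1 =
      ((((P * Y : 𝔸ˣ)) : 𝔸) - 1) + (P : 𝔸) * (((Rc E Y : 𝔸ˣ) : 𝔸) - Y) := by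
    rw [hbavg, Rc_mul, MonoidHom.comp_apply, ← hY]
    simp only [Units.val_mul]
    noncomm_ring
  rw [hid]
  calc _ ≤ ‖(((P * Y : 𝔸ˣ)) : 𝔸) - 1‖ + ‖(P : 𝔸) * (((Rc E Y : 𝔸ˣ) : 𝔸) - Y)‖ := norm_add_le _ _
    _ ≤ _ + 2 * (6 * ξ * M) :=
        add_le_add h199 ((norm_mul_le _ _).trans (mul_le_mul hPn hmove (norm_nonneg _) (by norm_num)))
    _ = _ := by rw [hξ, hM]; ring

/-- ★★ **PROPOSITION 9 AT A GENERAL BACKGROUND, FOR THE RECORD** (p. 49, (199)–(200)), packaged exactly as the hypotheses (180b)∕(180a) ONE SCALE UP: the coarse function `z ↦ ṽ′(Lz)` (`vtilGZ`) satisfies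
`CovBondBd` at the record's AVERAGED background `rescale L (bavgZ L V₀)` (`= avgIterZ L V₀ 1`) with the constant of `eq199Z_general`, and `SiteBd` with the constant of `eq200Z_general` — the input shape of the
induction (201)–(206) of Proposition 10 for the record.  Hypotheses as the engine's `prop9_general`, with the block condition on CENTRED blocks (`CovBlockBdZ`) and `L = 2s + 1`, `d ≥ 1`.
[cite: Balaban1985Averaging, Proposition 9 p.49, (199)–(200) p.49, (180) p.46, (42)–(43) pp.23–24; Balaban1987RG1, (0.4) p.253] -/
theorem prop9_generalZ (hLs : L = 2 * s + 1) (hd : 1 ≤ d) {V₀ : SiteZ d → Fin d → 𝔸ˣ} (hV : ∀ x κ, V₀ x κ ∈ U1 𝔸)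
    {α₀ : ℝ} (hα₀ : 0 ≤ α₀)
    (h44 : ∀ (x : SiteZ d) (κ μ : Fin d), κ ≠ μ → ‖((hol V₀ x (plaqWord κ μ) : 𝔸ˣ) : 𝔸) - 1‖ ≤ α₀)
    {v' v₁ : SiteZ d → 𝔸ˣ} {α₃ α₃' α₄ α₄' : ℝ}
    (h4a : SiteBd v' α₄) (h4b : CovBondBd V₀ v' α₄') (h3c : SiteBd v₁ α₃) (h3d : CovBlockBdZ L V₀ v₁ (L * α₃'))
    (hα₄ : α₄ ≤ 1 / 10) (hα₄' : 0 ≤ α₄') (hα₃ : α₃ ≤ 1 / 5) (hα₃' : 50 * (L * α₃') ≤ 1)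
    (hs : 1000 * ((d : ℝ) + 1) * L * (α₄' + 16 * ((d : ℝ) + 1) ^ 2 * L ^ 2 * α₀ * α₄) ≤ 1)
    (hα₀s : 512 * ((d : ℝ) + 1) * ((d : ℝ) + 4) * L ^ 2 * α₀ ≤ 1) :
    CovBondBd (B7Prop2Explicit.rescale L (bavgZ L V₀)) (fun z => vtilGZ L V₀ v' v₁ ((L : ℤ) • z))
        ((L * (α₄' + 16 * ((d : ℝ) + 1) ^ 2 * L ^ 2 * α₀ * α₄) +
            C4' d * L ^ 2 * (α₃' * (α₄' + 16 * ((d : ℝ) + 1) ^ 2 * L ^ 2 * α₀ * α₄) +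
              (α₄' + 16 * ((d : ℝ) + 1) ^ 2 * L ^ 2 * α₀ * α₄) ^ 2)) +
          384 * ((d : ℝ) + 1) * ((d : ℝ) + 4) * L ^ 2 * α₀ *
            (α₄ + C5' d * L * (α₄' + 4 * (d * L * α₀) * α₄))) ∧
      SiteBd (fun z => vtilGZ L V₀ v' v₁ ((L : ℤ) • z)) (α₄ + C5' d * L * (α₄' + 4 * (d * L * α₀) * α₄)) := by
  have hL : 1 ≤ L := by omega
  have hα₄0 : 0 ≤ α₄ := (norm_nonneg _).trans (h4a 0)
  have hdr : (0 : ℝ) ≤ d := Nat.cast_nonneg d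
  have hLr : (1 : ℝ) ≤ L := by exact_mod_cast hL
  have hs200 : 1000 * ((d : ℝ) + 1) * L * (α₄' + 4 * (d * L * α₀) * α₄) ≤ 1 := by
    have h1 : 4 * ((d : ℝ) * L * α₀) * α₄ ≤ 16 * ((d : ℝ) + 1) ^ 2 * L ^ 2 * α₀ * α₄ := by
      have h2 : (d : ℝ) * L ≤ 4 * ((d : ℝ) + 1) ^ 2 * L ^ 2 := by
        have hKL : 1 ≤ ((d : ℝ) + 1) * L := one_le_mul_of_one_le_of_one_le (by linarith) hLr
        have h5 : (d : ℝ) * L ≤ ((d : ℝ) + 1) * L := by nlinarith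
        have h6 : ((d : ℝ) + 1) * L ≤ (((d : ℝ) + 1) * L) ^ 2 := by nlinarith
        nlinarith
      have h3 := mul_le_mul_of_nonneg_right h2 (mul_nonneg hα₀ hα₄0)
      nlinarith
    have hpos : (0 : ℝ) ≤ 1000 * ((d : ℝ) + 1) * L := by positivity
    nlinarith [mul_le_mul_of_nonneg_left h1 hpos]
  refine ⟨fun z μ => ?_, fun z => ?_⟩
  · simp only [B7Prop2Explicit.rescale_apply]
    exact eq199Z_general hLs hd hV hα₀ h44 h4a h4b h3c h3d hα₄ hα₄' hα₃ hα₃' hs hα₀s z μ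
  · show ‖(((R0avgZ L V₀ (v' * v₁) ((L : ℤ) • z) * (R0avgZ L V₀ v₁ ((L : ℤ) • z))⁻¹ : 𝔸ˣ)) : 𝔸) - 1‖ ≤ _
    exact eq200Z_general hLs hV hα₀ h44 h4a h4b h3c h3d (hα₄.trans (by norm_num)) hα₄' hα₃ hα₃' hs200 z

end Prop9

end Literature.MathematicalPhysics.QuantumFieldTheory.Balaban1983to89.B7Eq199GeneralRec
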